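import Summits.BirchSwinnertonDyer.BirchSwinnertonDyer.Theses.KolyvaginRankRigidityAtTwo
import Summits.BirchSwinnertonDyer.BirchSwinnertonDyer.Theorems.KolyvaginRankRigidityAtTwoKolyvaginNonvanishingAtTwoFrameNonTorsionLevelOne
import Summits.BirchSwinnertonDyer.BirchSwinnertonDyer.Theorems.Rank1ResidualJetKolyvaginClassOrder
import HarnessLib

/-!
# Crux U1 `KolyvaginBoundedDefectAtTwo` (stmt-BirchSwinnertonDyer-28083; LINE 14 of pen bsd-idea-1 g7, SEED half of V1′∞ 27983):
# the DEPTH-ZERO RUNG — a frame whose `P(1) = y_K` has infinite order has bounded defect `m = ord₂`-divisibility of `P(1)`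
# at depth `r = 0`, at EVERY level `M > m` (helper, PROVED, unconditional; width seat `bsd-line-krr2-p2` g8)

U1 (Kolyvagin's Conjecture A at `2` in HIS exponent currency): on the V1′∞ frame there are a depth `r` and a defect bound `m`
such that at every level `M > m` some Kolyvagin conductor `n` of depth `r` with `M ≤ M(n)` carries `2^(M−m−1)·c_M(n) ≠ 0`.
The pen's docstring: «r = 0 is the regime y_K non-torsion (m = 2-divisibility exponent of y_K, Kummer injectivity as
E(K)[2^∞] = 0, M(1) = ∞): a first rung, not the content». This file IS that rung, kernel-checked: with `2^m ∥ P(1)` in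
`E(K[1])` (exists: `P(1)` has infinite order in the finitely generated `E(K[1])`), McCallum's order formula
`ord c_M(1) = 2^(M−m)` (tree: `JET.addOrderOf_kolyvaginClass_of_exactDepth`, standing inputs = admissibility at `2` on
the habitat `KolyvaginAtTwo.isAdmissible_pointsSubgroup_two_of_heegner` and the `Γ_K`-invariance of `[P(1)]`
`KolyvaginAtTwo.toGeomPoints_derivedPoint_one_mem_invPoints`) gives `2^(M−m−1)·c_M(1) ≠ 0` for every `M > m`.
HONEST FRAMING (critic #110: «a calibration, not progress on U1»): the torsion-`y_K` frames — Kolyvagin's conjecture at `2`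
proper — are NOT touched; `--supports stmt-BirchSwinnertonDyer-28083`; BSD is NOT proved by any of this.
References: [McCallumLMS1991] §5, proof of Prop. 5.2 (p. 305: «c_M(n) has order p^(M−M_r) iff p^(M_r) ∥ P_n»), §4 Cor. 4.5;
[GrossLMS1991] §4 (4.1), Prop. 4.7 (1), Lemma 4.3; [Kolyvagin1991MathAnn] §2.
-/

set_option autoImplicit false
-- the Theorems namespace of this sub repeats the summit name by design (D-0017 nested layout)
set_option linter.dupNamespace false

noncomputable section

open scoped Classical

open WeierstrassCurve Field Literature.NumberTheory.EllipticCurves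
  Literature.NumberTheory.EllipticCurves.ModularForms
open Summit.BirchSwinnertonDyer.BirchSwinnertonDyer.Theses.KolyvaginRankRigidityAtTwo

namespace Summit.BirchSwinnertonDyer.BirchSwinnertonDyer.Theorems.KolyvaginAtTwo

/-- **Exact `2`-divisibility depth of a point of infinite order** in a finitely generated abelian group: some `u` with
`2^u ∣ y` and `2^(u+1) ∤ y`. [folklore] -/
theorem exists_exactTwoDepth {A : Type*} [AddCommGroup A] [Module.Finite ℤ A] {y : A} (hy : ¬ IsOfFinAddOrder y) :
    ∃ u : ℕ, (∃ Q : A, ((2 ^ u : ℕ) : ℤ) • Q = y) ∧ ¬ ∃ Q : A, ((2 ^ (u + 1) : ℕ) : ℤ) • Q = y := by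
  obtain ⟨M₀, -, hM₀⟩ := exists_not_two_pow_zsmul_eq hy
  have hex : ∃ u : ℕ, ¬ ∃ Q : A, ((2 ^ u : ℕ) : ℤ) • Q = y := ⟨M₀, hM₀⟩
  have h0 : Nat.find hex ≠ 0 := by
    intro h
    have hspec := Nat.find_spec hex
    rw [h] at hspec
    exact hspec ⟨y, by simp⟩
  refine ⟨Nat.find hex - 1, ?_, ?_⟩
  · have hlt : Nat.find hex - 1 < Nat.find hex := by omega
    have h := Nat.find_min hex hlt
    rwa [not_not] at h
  · rw [Nat.sub_add_cancel (Nat.one_le_iff_ne_zero.mpr h0)]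
    exact Nat.find_spec hex

/-- **U1 at depth `r = 0` on a frame with `P(1)` of infinite order, per level** (the item's binders VERBATIM, then the
non-torsion hypothesis): with `m` the exact `2`-divisibility depth of `P(1)` in `E(K[1])`, for every `M > m` the class
`c_M(1)` has `2^(M−m−1)·c_M(1) ≠ 0` (its order is `2^(M−m)`), `n = 1` has depth `0` and `M ≤ M(1) = ∞`.
[cite: McCallumLMS1991, §5, proof of Prop. 5.2 (p. 305)] [cite: GrossLMS1991, Prop. 4.7 (1), Lemma 4.3] -/
theorem boundedDefectAtTwo_depthZero_of_nonTorsion :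
    ∀ (W : WeierstrassCurve ℚ) [W.IsElliptic] [W.IsGloballyMinimal], ¬ W.HasCM →
      (Literature.NumberTheory.EllipticCurves.Rank1Residual.GoodOrd W 2 ∨
        Literature.NumberTheory.EllipticCurves.Rank1Residual.Mult W 2) →
      (∀ m : ℕ, W.HasSurjectiveModNGaloisRep (2 ^ m : ℕ)) →
      ∀ (K : Type) [Field K] [NumberField K], Literature.NumberTheory.EllipticCurves.IsImaginaryQuadratic K →
      ∀ [NeZero (W.conductorNorm ℤ)],
      Literature.NumberTheory.EllipticCurves.SatisfiesHeegnerHypothesis (W.conductorNorm ℤ) K →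
      Odd (NumberField.discr K) → NumberField.discr K ≠ -3 →
      AddSubgroup.torsionBy (W.baseChange K).toAffine.Point (2 : ℤ) = ⊥ →
      Literature.NumberTheory.EllipticCurves.SatisfiesHeegnerHypothesis 2 K →
      ∀ (Dt : Literature.NumberTheory.EllipticCurves.ModularForms.ModularParametrizationData W (W.conductorNorm ℤ))
        (β : ℤ) (ι : K →+* ℂ), (4 * (W.conductorNorm ℤ : ℤ)) ∣ β ^ 2 - NumberField.discr K →
      (∃ d₁ : Literature.NumberTheory.EllipticCurves.KolyvaginHeegnerData Dt β ι 1, ¬ IsOfFinAddOrder d₁.derivedPoint) →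
      ∃ m : ℕ, ∀ M : ℕ, m < M →
        ∃ (n : ℕ) (d : Literature.NumberTheory.EllipticCurves.KolyvaginHeegnerData Dt β ι n),
          Literature.NumberTheory.EllipticCurves.KolyvaginDescent.KolSupp
            (Literature.NumberTheory.EllipticCurves.Zhang2014.IsKolyvaginPrime (W.conductorNorm ℤ) W K 2) n ∧
          n.primeFactors.card = 0 ∧
          ((M : ℕ) : ℕ∞) ≤ Literature.NumberTheory.EllipticCurves.Zhang2014.levelIndex W 2 n ∧
          (2 ^ (M - m - 1) : ℤ) • d.kolyvaginClass Nat.prime_two M ≠ 0 := by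
  intro W _ _ _ _ hsur K _ _ hK _ hHN hodd _ _ _ Dt β ι _ hex
  obtain ⟨d₁, hnt⟩ := hex
  have hs : W.HasSurjectiveModNGaloisRep 2 := by simpa using hsur 1
  -- `E(K[1])` is finitely generated (Mordell–Weil over the number field `K[1]`)
  haveI := (finiteDimensional_and_isGalois_ringClassField hK ι one_ne_zero).1
  haveI : NumberField (ringClassField K ι 1) := NumberField.of_module_finite K _
  haveI : (W.baseChange (ringClassField K ι 1)).IsElliptic := by rw [baseChange]; infer_instance
  haveI : Module.Finite ℤ (W.baseChange (ringClassField K ι 1)).toAffine.Point := by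
    convert (W.baseChange (ringClassField K ι 1)).module_finite_point_holds
  -- the exact `2`-divisibility depth `m` of `P(1)`
  obtain ⟨m, hdvd, hndvd⟩ := exists_exactTwoDepth
    (A := (W.baseChange (ringClassField K ι 1)).toAffine.Point) (y := d₁.derivedPoint) (by convert hnt)
  refine ⟨m, fun M hM ↦ ⟨1, d₁, KolyvaginDescent.kolSupp_one _, by simp, by simp [Zhang2014.levelIndex_one], ?_⟩⟩
  -- the order of `c_M(1)` is `2^(M-m)` (McCallum p. 305), from the standing inputs on the habitat
  have hA := isAdmissible_pointsSubgroup_two_of_heegner d₁ hs hK hodd hHN one_ne_zero M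
  have hP := toGeomPoints_derivedPoint_one_mem_invPoints hK hHN d₁ ((2 ^ M : ℕ) : ℤ)
  have hord := Summit.BirchSwinnertonDyer.Rank1Residual.JET.addOrderOf_kolyvaginClass_of_exactDepth d₁
    Nat.prime_two hM.le hA hP (by convert hdvd) (by convert hndvd)
  -- so `2^(M-m-1) • c_M(1) ≠ 0`
  intro h0
  have h0' : (2 ^ (M - m - 1)) • d₁.kolyvaginClass Nat.prime_two M = 0 := by
    rw [← natCast_zsmul]; push_cast; exact h0
  have hdv : 2 ^ (M - m) ∣ 2 ^ (M - m - 1) := by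
    rw [← hord]; exact addOrderOf_dvd_of_nsmul_eq_zero h0'
  have hle := (Nat.pow_dvd_pow_iff_le_right one_lt_two).mp hdv
  omega

/-- **The depth-zero rung in U1's shape** (`∃ r m, …` with `r = 0`): the item's conclusion on every frame whose `P(1)` has
infinite order. [cite: McCallumLMS1991, §5, proof of Prop. 5.2 (p. 305)] [cite: Kolyvagin1991MathAnn, §2] -/
theorem boundedDefectAtTwo_of_nonTorsion :
    ∀ (W : WeierstrassCurve ℚ) [W.IsElliptic] [W.IsGloballyMinimal], ¬ W.HasCM →
      (Literature.NumberTheory.EllipticCurves.Rank1Residual.GoodOrd W 2 ∨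
        Literature.NumberTheory.EllipticCurves.Rank1Residual.Mult W 2) →
      (∀ m : ℕ, W.HasSurjectiveModNGaloisRep (2 ^ m : ℕ)) →
      ∀ (K : Type) [Field K] [NumberField K], Literature.NumberTheory.EllipticCurves.IsImaginaryQuadratic K →
      ∀ [NeZero (W.conductorNorm ℤ)],
      Literature.NumberTheory.EllipticCurves.SatisfiesHeegnerHypothesis (W.conductorNorm ℤ) K →
      Odd (NumberField.discr K) → NumberField.discr K ≠ -3 →
      AddSubgroup.torsionBy (W.baseChange K).toAffine.Point (2 : ℤ) = ⊥ →
      Literature.NumberTheory.EllipticCurves.SatisfiesHeegnerHypothesis 2 K →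
      ∀ (Dt : Literature.NumberTheory.EllipticCurves.ModularForms.ModularParametrizationData W (W.conductorNorm ℤ))
        (β : ℤ) (ι : K →+* ℂ), (4 * (W.conductorNorm ℤ : ℤ)) ∣ β ^ 2 - NumberField.discr K →
      (∃ d₁ : Literature.NumberTheory.EllipticCurves.KolyvaginHeegnerData Dt β ι 1, ¬ IsOfFinAddOrder d₁.derivedPoint) →
      ∃ r m : ℕ, ∀ M : ℕ, m < M →
        ∃ (n : ℕ) (d : Literature.NumberTheory.EllipticCurves.KolyvaginHeegnerData Dt β ι n),
          Literature.NumberTheory.EllipticCurves.KolyvaginDescent.KolSupp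
            (Literature.NumberTheory.EllipticCurves.Zhang2014.IsKolyvaginPrime (W.conductorNorm ℤ) W K 2) n ∧
          n.primeFactors.card = r ∧
          ((M : ℕ) : ℕ∞) ≤ Literature.NumberTheory.EllipticCurves.Zhang2014.levelIndex W 2 n ∧
          (2 ^ (M - m - 1) : ℤ) • d.kolyvaginClass Nat.prime_two M ≠ 0 :=
  fun W _ _ hCM hred hsur K _ _ hK _ hHN hodd hne3 htor hH2 Dt β ι hβ hex ↦
    ⟨0, boundedDefectAtTwo_depthZero_of_nonTorsion W hCM hred hsur K hK hHN hodd hne3 htor hH2 Dt β ι hβ hex⟩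

end Summit.BirchSwinnertonDyer.BirchSwinnertonDyer.Theorems.KolyvaginAtTwo

end
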